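import Literature.Computability.AlgebraicComplexity.BorderRankMatMulSmall
import Literature.Computability.AlgebraicComplexity.SchoenhageTauBini
import HarnessLib

/-!
# `bR(⟨2,3,3⟩) ≤ 14` (Smirnov 2013, Table 4): the upper half of `R̲(M_⟨233⟩) = 14`, proved

Topic `Literature/Computability/AlgebraicComplexity`; sibling of `BorderRankMatMulSmall.lean`, whose
named fact `ConnerHarperLandsberg2023_thm_1_4_233 : algBorderRank (matMulTensor ℂ 2 3 3) = 14`
(Conner–Harper–Landsberg, Forum Math. Pi 11 (2023) e17, Thm. 1.5(1) of the published version =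
Thm. 1.4 of arXiv:1911.07981, the numbering used in the sibling's docstring: "`R̲(M_⟨233⟩) = 14` …
The upper bound in (1) is due to Smirnov [38]") is an equality of two halves of very different
weight:

* `≤ 14` — A. V. Smirnov, *The bilinear complexity and practical algorithms for matrix
  multiplication*, Zh. Vychisl. Mat. Mat. Fiz. 53 (2013) 1970–1984 = Comput. Math. Math. Phys. 53
  (2013) 1781–1795, **Table 4** (p. 1980 of the Russian original): "Алгоритм приближенного умножения
  матрицы `3 × 2` на матрицу `2 × 3` с 14 активными умножениями" — an explicit approximate bilinear
  algorithm `⟨3,2,3; 14⟩` with Laurent-polynomial coefficients in `{0, ±1, ±x^{±1}, ±x², x³, 1 + x²,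
  x + x², x² + x³}`, valid "над любым полем" (over any field; p. 1981: "Это решение имеет третий
  полиномиальный порядок"). THIS FILE PROVES IT, for every commutative ring, by a kernel-checked
  certificate.
* `≥ 14` — CHL 2023, proof of Thm. 1.5(1) (p. 27: `u = w = 3`, `v = 2`; the eight outer structures
  of `B`-fixed `4`-planes in `U* ⊗ 𝔰𝔩(V) ⊗ W`, the `(210)`/`(120)` tests and Lemma 7.2), resting
  on border apolarity with the Borel-fixed normal form (Buczyńska–Buczyński; multigraded Hilbert
  scheme, Borel fixed point theorem) — a theory the tree does not have. NOT proved here; the named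
  fact is reduced to exactly this half (`ConnerHarperLandsberg2023_thm_1_4_233_iff_lower`).

## The certificate (everything auxiliary is in the sub-namespace `Smirnov2013`)

Smirnov's Table 4 lists, for `t = 1, …, 14`, matrices `γᵗ ∈ ℤ[x,x⁻¹]^{3×3}` (on the product
`C = AB`), `αᵗ ∈ ℤ[x,x⁻¹]^{3×2}` (on `A`), `βᵗ ∈ ℤ[x,x⁻¹]^{2×3}` (on `B`) with
`∑ₜ γᵗ_{i₁i₂} αᵗ_{j₁j₂} βᵗ_{k₁k₂} = δ_{i₁j₁} δ_{j₂k₁} δ_{k₂i₂} + O(x)`. Multiplying each of the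
three factors by `x` gives polynomial vectors `Uₜ = x γᵗ`, `Vₜ = x αᵗ`, `Wₜ = x βᵗ` over `ℤ` with
`∑ₜ Uₜ ⊗ Vₜ ⊗ Wₜ = x³ · ⟨3,2,3⟩ + O(x⁴)`, i.e. an order-`3` approximate decomposition of
`matMulTensor K 3 2 3` with `14` triads in the sense of Bläser's Def. 6.1 (`IsApproxDecomposition`).

* `toPoly`, `coeffL`, `padd`, `psmul`, `pmul`, `psum` — dense integer polynomials in `x` as
  ascending coefficient lists, their values in `K[X]` and the homomorphism lemmas (`coeff_toPoly`,
  `toPoly_padd`, `toPoly_pmul`, `toPoly_psum`).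
* `uMats`, `vMats`, `wMats` — the data `x γᵗ`, `x αᵗ`, `x βᵗ` transcribed from Table 4 (entry =
  coefficient list; e.g. the printed `−x⁻¹` is `[-1]`, `1 + x²` is `[0, 1, 0, 1]`).
* `entryPoly`, `rhsZ`, `table4Check`, `table4Check_eq_true` — for each of the `9·6·6` entries the
  integer polynomial `∑ₜ Uₜ(i,l) Vₜ(j,m) Wₜ(k,n)` is formed once and its coefficients in degrees
  `0,…,3` are compared with `x³ ⟨3,2,3⟩`; the kernel runs the check (`decide +kernel`; no
  `native_decide`).
* `isApproxDecomposition_table4` — transport to `K[X]` for any commutative ring `K`.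

Then `approxRank_three_matMulTensor_323_le` (`R₃(⟨3,2,3⟩) ≤ 14`),
`Smirnov2013_algBorderRank_matMulTensor_323_le / _233_le / _332_le` (the three cyclic formats, by
`approxRank_matMulTensor_rotate_le`), and `ConnerHarperLandsberg2023_thm_1_4_233_iff_lower`.

How the data were obtained: the table was read off the content stream of the mathnet.ru PDF of the
Russian original (glyph positions, superscripts by font size) and checked in exact integer
arithmetic before transcription; the kernel check below is the proof, the transcription route is not
trusted.

## References

* [Smirnov2013] A. V. Smirnov, Zh. Vychisl. Mat. Mat. Fiz. 53:12 (2013) 1970–1984; Comput. Math.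
  Math. Phys. 53 (2013) 1781–1795, doi:10.1134/S0965542513120129 — Table 4 (p. 1980), text p. 1981.
* [ConnerHarperLandsberg2023] A. Conner, A. Harper, J. M. Landsberg, Forum Math. Pi 11 (2023) e17,
  doi:10.1017/fmp.2023.14 = arXiv:1911.07981 — Thm. 1.5(1) (published numbering) = Thm. 1.4 (arXiv),
  proof on p. 27.
* [Blaser2013] M. Bläser, *Fast Matrix Multiplication*, Theory of Computing Library, Graduate
  Surveys 5 (2013) — Def. 6.1 (`R_h`, border rank over `K[ε]`), Thm. 6.3(1) (rotations).
-/

noncomputable section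

open scoped BigOperators Polynomial
open Polynomial

namespace Literature.Computability.AlgebraicComplexity

namespace Smirnov2013

/-! ## Dense integer polynomials in `x` -/

section Poly

variable {K : Type*} [CommRing K]

/-- The polynomial `c₀ + c₁ x + c₂ x² + ⋯ ∈ K[x]` of an ascending integer coefficient list.
[folklore] -/
def toPoly : List ℤ → K[X]
  | [] => 0
  | c :: cs => C (c : K) + X * toPoly cs

/-- The degree-`d` coefficient of an ascending coefficient list (`0` past the end). [folklore] -/
def coeffL : List ℤ → ℕ → ℤ
  | [], _ => 0
  | c :: _, 0 => c
  | _ :: cs, d + 1 => coeffL cs d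

/-- Coefficientwise sum (the shorter list padded with zeros). [folklore] -/
def padd : List ℤ → List ℤ → List ℤ
  | [], l => l
  | a :: as, [] => a :: as
  | a :: as, b :: bs => (a + b) :: padd as bs

/-- Integer multiple of a coefficient list. [folklore] -/
def psmul (c : ℤ) : List ℤ → List ℤ
  | [] => []
  | b :: bs => c * b :: psmul c bs

/-- Schoolbook product of coefficient lists. [folklore] -/
def pmul : List ℤ → List ℤ → List ℤ
  | [], _ => []
  | a :: as, b => padd (psmul a b) (0 :: pmul as b)

/-- Sum of a list of coefficient lists. [folklore] -/
def psum : List (List ℤ) → List ℤ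
  | [] => []
  | l :: ls => padd l (psum ls)

/-- `toPoly` has the listed coefficients. [folklore] -/
theorem coeff_toPoly : ∀ (l : List ℤ) (d : ℕ), (toPoly l : K[X]).coeff d = (coeffL l d : K)
  | [], d => by simp [toPoly, coeffL]
  | c :: cs, 0 => by simp [toPoly, coeffL]
  | c :: cs, d + 1 => by
    rw [toPoly, coeffL, coeff_add, coeff_C_succ, coeff_X_mul, zero_add, coeff_toPoly cs d]

/-- `padd` is addition. [folklore] -/
theorem toPoly_padd : ∀ a b : List ℤ, (toPoly (padd a b) : K[X]) = toPoly a + toPoly b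
  | [], l => by simp [padd, toPoly]
  | a :: as, [] => by simp [padd, toPoly]
  | a :: as, b :: bs => by
    rw [padd, toPoly, toPoly, toPoly, toPoly_padd as bs, Int.cast_add, C_add]
    ring

/-- `psmul` is multiplication by a constant. [folklore] -/
theorem toPoly_psmul (c : ℤ) : ∀ b : List ℤ, (toPoly (psmul c b) : K[X]) = C (c : K) * toPoly b
  | [] => by simp [psmul, toPoly]
  | b :: bs => by
    rw [psmul, toPoly, toPoly, toPoly_psmul c bs, Int.cast_mul, C_mul]
    ring

/-- `pmul` is multiplication. [folklore] -/
theorem toPoly_pmul : ∀ a b : List ℤ, (toPoly (pmul a b) : K[X]) = toPoly a * toPoly b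
  | [], b => by simp [pmul, toPoly]
  | a :: as, b => by
    rw [pmul, toPoly_padd, toPoly_psmul, toPoly, toPoly, toPoly_pmul as b, Int.cast_zero, C_0,
      zero_add]
    ring

/-- `psum` is the sum. [folklore] -/
theorem toPoly_psum : ∀ L : List (List ℤ), (toPoly (psum L) : K[X]) = (L.map toPoly).sum
  | [] => by simp [psum, toPoly]
  | l :: ls => by rw [psum, toPoly_padd, toPoly_psum ls, List.map_cons, List.sum_cons]

end Poly

/-! ## The data of Smirnov's Table 4, multiplied by `x` -/

/-- `Uₜ = x · γᵗ ∈ ℤ[x]^{3×3}` (`t = 1, …, 14`): the coefficient matrices on the product `C = AB`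
(`3 × 3`) of Smirnov's Table 4, times `x`, as ascending coefficient lists.
[cite: Smirnov2013, Table 4] -/
def uMats : List (Fin 3 → Fin 3 → List ℤ) :=
  [![![[], [0, -1], [0, 1]], ![[0, -1], [0, 1], [-1]], ![[0, 0, 1], [-1], [1]]],
    ![![[0, 0, 1], [], [0, 0, 0, -1]], ![[], [], [1]], ![[1], [0, -1], [-1]]],
    ![![[0, 0, 0, -1], [], [0, 0, 0, 1]], ![[], [], []], ![[], [], [1]]],
    ![![[], [], []], ![[0, 1], [], [1]], ![[0, 0, -1], [0, -1], []]],
    ![![[], [], [0, 0, 0, 1]], ![[], [], []], ![[], [], [1]]],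
    ![![[], [], []], ![[], [], [-1]], ![[], [0, 1], []]],
    ![![[0, 0, 1], [], []], ![[], [], []], ![[1], [], []]],
    ![![[], [], []], ![[0, 1], [0, -1], [1]], ![[0, 0, -1], [], []]],
    ![![[], [], []], ![[], [], [-1]], ![[], [], []]],
    ![![[], [0, 0, 0, 1], [0, 1]], ![[], [], []], ![[], [], [1]]],
    ![![[], [], [0, 1]], ![[], [], []], ![[], [], [1]]],
    ![![[0, 0, 0, 1, 1], [], []], ![[0, 1], [0, -1], [1]], ![[], [], []]],
    ![![[], [0, 1], []], ![[], [], []], ![[], [1], []]],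
    ![![[], [], []], ![[], [0, -1], [1]], ![[], [], []]]]

/-- `Vₜ = x · αᵗ ∈ ℤ[x]^{3×2}`: the coefficient matrices on the left factor `A` (`3 × 2`) of
Smirnov's Table 4, times `x`. [cite: Smirnov2013, Table 4] -/
def vMats : List (Fin 3 → Fin 2 → List ℤ) :=
  [![![[], [1]], ![[0, 0, 1], []], ![[], []]],
    ![![[], [1]], ![[], []], ![[0, 0, 0, 1], [0, -1]]],
    ![![[-1], []], ![[], []], ![[0, 1, 0, 1], []]],
    ![![[], []], ![[0, 1], []], ![[], []]],
    ![![[-1], [-1]], ![[], []], ![[0, 1], [0, 1]]],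
    ![![[], [-1]], ![[0, 0, -1], []], ![[0, 0, 0, -1], [0, 1]]],
    ![![[], [-1]], ![[0, 0, 0, 0, 1], []], ![[], [0, 1]]],
    ![![[], [-1]], ![[], []], ![[], []]],
    ![![[], [1]], ![[0, 0, 1], [0, -1]], ![[0, 0, 0, 1], [0, -1]]],
    ![![[1], []], ![[], []], ![[], []]],
    ![![[1], [1]], ![[0, 0, 1], []], ![[], []]],
    ![![[], [1]], ![[], [0, 0, 1]], ![[], []]],
    ![![[], [1]], ![[0, 0, 1, 1], []], ![[0, 0, 0, 1], []]],
    ![![[], []], ![[], [0, 1]], ![[], []]]]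

/-- `Wₜ = x · βᵗ ∈ ℤ[x]^{2×3}`: the coefficient matrices on the right factor `B` (`2 × 3`) of
Smirnov's Table 4, times `x`. [cite: Smirnov2013, Table 4] -/
def wMats : List (Fin 2 → Fin 3 → List ℤ) :=
  [![![[], [1], []], ![[], [], []]],
    ![![[1], [], []], ![[], [], []]],
    ![![[1], [], [0, 0, 1]], ![[], [], [0, 0, -1]]],
    ![![[0, 1], [0, 1], [0, 0, 1]], ![[], [], []]],
    ![![[-1], [], []], ![[], [], [0, 0, 1]]],
    ![![[-1], [], []], ![[], [0, 1], []]],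
    ![![[1], [], []], ![[0, 0, 1], [], []]],
    ![![[], [-1], []], ![[1], [], []]],
    ![![[], [], []], ![[], [0, 1], []]],
    ![![[], [1], [0, 0, 1]], ![[], [], [0, 0, -1]]],
    ![![[], [-1], []], ![[], [], [0, 0, 1]]],
    ![![[], [], []], ![[1], [], []]],
    ![![[], [1], []], ![[], [0, 0, 1], []]],
    ![![[], [], []], ![[0, -1], [0, -1], [0, 0, 1]]]]

/-- `Uₜ` indexed by `t : Fin 14`. [cite: Smirnov2013, Table 4] -/
def uTab (t : Fin 14) : Fin 3 → Fin 3 → List ℤ := uMats.getD t fun _ _ => []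

/-- `Vₜ` indexed by `t : Fin 14`. [cite: Smirnov2013, Table 4] -/
def vTab (t : Fin 14) : Fin 3 → Fin 2 → List ℤ := vMats.getD t fun _ _ => []

/-- `Wₜ` indexed by `t : Fin 14`. [cite: Smirnov2013, Table 4] -/
def wTab (t : Fin 14) : Fin 2 → Fin 3 → List ℤ := wMats.getD t fun _ _ => []

/-! ## The finite check -/

/-- The integer polynomial `∑ₜ Uₜ(i,l) Vₜ(j,m) Wₜ(k,n)`: entry `((i,l),(j,m),(k,n))` of
`∑ₜ Uₜ ⊗ Vₜ ⊗ Wₜ`. [cite: Smirnov2013, Table 4] -/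
def entryPoly (i l j : Fin 3) (m k : Fin 2) (n : Fin 3) : List ℤ :=
  psum (List.ofFn fun t : Fin 14 => pmul (pmul (uTab t i l) (vTab t j m)) (wTab t k n))

/-- The expected coefficients: `x³ · ⟨3,2,3⟩`, i.e. `1` in degree `3` at the entries
`((i,l),(i,m),(m,l))` and `0` otherwise / below. [cite: Smirnov2013, Table 4] -/
def rhsZ (i l j : Fin 3) (m k : Fin 2) (n : Fin 3) (d : ℕ) : ℤ :=
  if d = 3 then (if i = j ∧ m = k ∧ l = n then 1 else 0) else 0

/-- The whole finite check: all `9 · 6 · 6` entries, degrees `0, …, 3`.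
[cite: Smirnov2013, Table 4] -/
def table4Check : Bool :=
  (List.finRange 3).all fun i => (List.finRange 3).all fun l => (List.finRange 3).all fun j =>
    (List.finRange 2).all fun m => (List.finRange 2).all fun k => (List.finRange 3).all fun n =>
      (List.range 4).all fun d => coeffL (entryPoly i l j m k n) d == rhsZ i l j m k n d

/-- The kernel runs the check. [cite: Smirnov2013, Table 4] -/
theorem table4Check_eq_true : table4Check = true := by
  decide +kernel

/-- Unpacking `table4Check`: entry by entry, degree by degree. [cite: Smirnov2013, Table 4] -/
theorem coeffL_entryPoly (i l j : Fin 3) (m k : Fin 2) (n : Fin 3) {d : ℕ} (hd : d ≤ 3) :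
    coeffL (entryPoly i l j m k n) d = rhsZ i l j m k n d := by
  have h := table4Check_eq_true
  simp only [table4Check, List.all_eq_true, beq_iff_eq] at h
  exact h i (List.mem_finRange i) l (List.mem_finRange l) j (List.mem_finRange j)
    m (List.mem_finRange m) k (List.mem_finRange k) n (List.mem_finRange n) d
    (List.mem_range.2 (by omega))

/-! ## Transport to `K[x]` -/

section Transport

variable (K : Type*) [CommRing K]

/-- First vectors `Uₜ ∈ K[x]^{3×3}` (slot of the product `C`, index `(i,l)`).
[cite: Smirnov2013, Table 4] -/
def uC (t : Fin 14) (a : Fin 3 × Fin 3) : K[X] := toPoly (uTab t a.1 a.2)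

/-- Second vectors `Vₜ ∈ K[x]^{3×2}` (slot of `A`, index `(j,m)`). [cite: Smirnov2013, Table 4] -/
def vC (t : Fin 14) (b : Fin 3 × Fin 2) : K[X] := toPoly (vTab t b.1 b.2)

/-- Third vectors `Wₜ ∈ K[x]^{2×3}` (slot of `B`, index `(k,n)`). [cite: Smirnov2013, Table 4] -/
def wC (t : Fin 14) (c : Fin 2 × Fin 3) : K[X] := toPoly (wTab t c.1 c.2)

/-- **Smirnov's Table 4 as an order-`3` approximate decomposition of `⟨3,2,3⟩` with `14` triads**,
over every commutative ring: `∑ₜ Uₜ ⊗ Vₜ ⊗ Wₜ = x³ ⟨3,2,3⟩ + O(x⁴)`. [cite: Smirnov2013, Table 4] -/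
theorem isApproxDecomposition_table4 :
    IsApproxDecomposition 3 (matMulTensor K 3 2 3) (uC K) (vC K) (wC K) := by
  intro a b c d hd
  have hsum : (∑ t, uC K t a * vC K t b * wC K t c) =
      toPoly (entryPoly a.1 a.2 b.1 b.2 c.1 c.2) := by
    rw [entryPoly, toPoly_psum, List.map_ofFn, List.sum_ofFn]
    refine Finset.sum_congr rfl fun t _ => ?_
    simp only [Function.comp_apply, toPoly_pmul, uC, vC, wC]
  rw [hsum, coeff_toPoly, coeffL_entryPoly _ _ _ _ _ _ hd, rhsZ]
  simp only [matMulTensor]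
  split_ifs <;> simp

end Transport

end Smirnov2013

/-! ## The bounds -/

/-- **`R₃(⟨3,2,3⟩) ≤ 14`** over every commutative ring (order-`3` approximate rank, Bläser's `R_h`):
Smirnov's `⟨3,2,3; 14⟩` scheme of polynomial order three. [cite: Smirnov2013, Table 4] -/
theorem approxRank_three_matMulTensor_323_le (K : Type*) [CommRing K] :
    approxRank 3 (matMulTensor K 3 2 3) ≤ 14 :=
  approxRank_le_of_isApproxDecomposition (Smirnov2013.isApproxDecomposition_table4 K)

/-- **Smirnov 2013: `bR(⟨3,2,3⟩) ≤ 14`** (a `3 × 2` by a `2 × 3` matrix; "над любым полем" — here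
every commutative ring). [cite: Smirnov2013, Table 4] -/
theorem Smirnov2013_algBorderRank_matMulTensor_323_le (K : Type*) [CommRing K] :
    algBorderRank (matMulTensor K 3 2 3) ≤ 14 :=
  (algBorderRank_le_approxRank 3 _).trans (approxRank_three_matMulTensor_323_le K)

/-- **Smirnov 2013: `bR(⟨2,3,3⟩) ≤ 14`** (a `2 × 3` by a `3 × 3` matrix — the format of
`ConnerHarperLandsberg2023_thm_1_4_233`; cyclic rotation of `⟨3,2,3⟩`, Bläser Thm. 6.3(1)). This is
the upper bound of CHL 2023, Thm. 1.5(1) ("due to Smirnov"). [cite: Smirnov2013, Table 4] -/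
theorem Smirnov2013_algBorderRank_matMulTensor_233_le (K : Type*) [CommRing K] :
    algBorderRank (matMulTensor K 2 3 3) ≤ 14 :=
  (algBorderRank_le_approxRank 3 _).trans
    ((approxRank_matMulTensor_rotate_le K 3 3 2 3).trans (approxRank_three_matMulTensor_323_le K))

/-- **Smirnov 2013: `bR(⟨3,3,2⟩) ≤ 14`** (a `3 × 3` by a `3 × 2` matrix; the third cyclic format).
[cite: Smirnov2013, Table 4] -/
theorem Smirnov2013_algBorderRank_matMulTensor_332_le (K : Type*) [CommRing K] :
    algBorderRank (matMulTensor K 3 3 2) ≤ 14 :=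
  (algBorderRank_le_approxRank 3 _).trans
    ((approxRank_matMulTensor_rotate_le K 3 2 3 3).trans
      ((approxRank_matMulTensor_rotate_le K 3 3 2 3).trans
        (approxRank_three_matMulTensor_323_le K)))

/-- With the upper bound proved, the named fact `R̲(M_⟨233⟩) = 14` (CHL 2023, Thm. 1.5(1) of the
published version = Thm. 1.4 of arXiv:1911.07981) is EQUIVALENT to its lower half
`14 ≤ bR(⟨2,3,3⟩)`, the border-apolarity bound. [cite: ConnerHarperLandsberg2023, Thm. 1.5(1)] -/
theorem ConnerHarperLandsberg2023_thm_1_4_233_iff_lower :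
    ConnerHarperLandsberg2023_thm_1_4_233 ↔ 14 ≤ algBorderRank (matMulTensor ℂ 2 3 3) := by
  unfold ConnerHarperLandsberg2023_thm_1_4_233
  exact ⟨fun h => h.ge, fun h => le_antisymm (Smirnov2013_algBorderRank_matMulTensor_233_le ℂ) h⟩

end Literature.Computability.AlgebraicComplexity

end
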